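import Literature.Probability.RandomPlanarGeometry.HexSAWSurfaceWallRenewalBlocksEightA
import Literature.Probability.RandomPlanarGeometry.HexSAWSurfaceWallRenewalBlocksEightB
import Literature.Probability.RandomPlanarGeometry.HexSAWSurfaceWallRenewalSeventhExactMean
import Literature.Probability.RandomPlanarGeometry.HexSAWSurfaceWallRenewalSixthLower
import HarnessLib

/-!
# An eighth-order floor for `β(y)²`: `liminf y⁷ (β(y)² − y − 1/y − 1/y² − 2/y³ − 4/y⁴ − 6/y⁵ − 12/y⁶) ≥ 18`

`β(y) = wallRate y` is the exponential growth rate of wall bridges of self-avoiding walks on the brick-wall (hexagonal) lattice along a zigzag wall with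
contact fugacity `y` («WALL-BRIDGES»).  The lane's strong-adsorption expansion reads `β(y)² = y + 1/y + 1/y² + 2/y³ + 4/y⁴ + 6/y⁵ + 12/y⁶ + o(y⁻⁶)`, every
coefficient EXACT (…, «SIXTH-LOWER», «A6-EXACT» `HexSAWSurfaceWallRenewalSeventhExact`).  This module proves the next order FROM BELOW:

  ★★ `eventually_eighteen_sub_le_pow_seven_mul_wallRate_sq_sub : ∀ ε > 0, ∀ᶠ y, 18 − ε ≤ y⁷ (β(y)² − y − 1/y − 1/y² − 2/y³ − 4/y⁴ − 6/y⁵ − 12/y⁶)`,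

equivalently `β(y)² ≥ y + 1/y + 1/y² + 2/y³ + 4/y⁴ + 6/y⁵ + 12/y⁶ + (18 − ε)/y⁷` eventually (`eventually_eighth_order_floor`), and
`eighteen_le_of_tendsto_pow_seven_mul_wallRate_sq_sub : (y⁷(…) → L) → 18 ≤ L`.  `18 = 231 − 213` is the lane's prediction `a₇ = 18` of the 20th
«Question for Ben Adlam» (PLAN am.50): the floor half is now a theorem; the matching ceiling waits for the kernel census of the diagonal `s − v = 8`.

METHOD («SEVENTH-FLOOR» one diagonal further).  Kesten's identity `Σ_s f_s(y) = 1` (`hasSum_pwbLaw_of_cube_lt`, `y > μ³`; [MadrasSlade1993, §4.2, (4.2.4),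
Theorem 4.2.2], [Kesten 1963, §4]) restricted to the EXHIBITED irreducible classes `(s, v)` with `s − v ≤ 8` — the exact laws `f₃ … f₈` of the tree
(«EXCESS-LIMIT» … «SEVEN-CENSUS»: `f₆ = (6y + y²)/β¹²`, `f₇ = (15y + 3y²)/β¹⁴`, `f₈ = (38y + 11y²)/β¹⁶`) and the 231 exhibits of «BLOCKS-EIGHT-A/B»
(`98y + 34y² + y³ ≤ Λ₁₈`, `99y² + 7y³ ≤ Λ₂₀`, `33y³ ≤ Λ₂₂`, `y⁴ ≤ Λ₂₄`) — gives, with `B = β²` (§2),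

  `y/B + y/B³ + y/B⁴ + 3y/B⁵ + (6y + y²)/B⁶ + (15y + 3y²)/B⁷ + (38y + 11y²)/B⁸ + (98y + 34y² + y³)/B⁹ + (99y² + 7y³)/B¹⁰ + 33y³/B¹¹ + y⁴/B¹² ≤ 1`,

and multiplying by `y⁷B` the closed form (§3), with `r = y/B`,

  `T(y) := y⁷(β² − y − 1/y − 1/y² − 2/y³ − 4/y⁴ − 6/y⁵ − 12/y⁶) ≥ G(y, r) := y⁶(r² − 1) + y⁵(r³ − 1) + y⁴(3r⁴ + r⁵ − 2) + y³(6r⁵ + 3r⁶ − 4)`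
  `+ y²(15r⁶ + 11r⁷ + r⁸ − 6) + y(38r⁷ + 34r⁸ + 7r⁹ − 12) + (98r⁸ + 99r⁹ + 33r¹⁰ + r¹¹)`.

The divergences of `G` cancel against the known orders `1, 1, 2, 4, 6` through the `β²`-tower `A = y²(1 − r) → 1`, `Q = y³(1 − r) − y → 1`, `P = y⁴(1 − r) − y² −
y → 1`, `H = y⁵(1 − r) − y³ − y² − y → 2` (tree) and the NEW sixth rung `K = y⁶(1 − r) − y⁴ − y³ − y² − 2y → 2` (§1, from `a₅ = 6`): `G = Φ(A, Q, P, H, K, 1/y)`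
IDENTICALLY for an explicit polynomial `Φ` (45 monomials, `ring`) with `Φ(1, 1, 1, 2, 2, 0) = 18`.  Hence `G → 18` (§4) and `liminf T ≥ 18`.  The exactness of the
seventh coefficient `a₆ = 12` is NOT used (`12/y⁶` is merely subtracted).

HONEST LABEL.  LANE THEOREM (a one-sided bound) for this model, DERIVED from the exhibited tables (this seat's «BLOCKS-EIGHT-A/B», a-idea-1's «BLOCKS»/«BLOCKS-SEVEN»)
and Kesten's relation; the printed sources carry the first-order statement `β ∼ √y` only ([BeatonBousquetMelouDeGierDuminilCopinGuttmann2014, §3.1, Proposition 5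
and the remark on p. 10 (arXiv v5)]) and the general renewal theory ([MadrasSlade1993, §4.2], [Kesten 1963, §4]); the floor `18` is computed in this lane — NEW IN
WRITING (modest), not a quotation.  NOT CLAIMED: the eighth-order LIMIT `a₇ = 18` (it needs the completeness of the four diagonal-8 classes — «CENSUS-EIGHT»),
anything for `y ≤ μ³`, the armchair wall, numerics.  No definitions.
-/

namespace Literature.Probability.RandomPlanarGeometry.SAW.HexBW.Wall

open Finset Filter Function
open Literature.Probability.LatticeModels
open _root_.Topology Asymptotics

variable {y : ℝ}

/-! ### §0  Private plumbing -/

/-- [folklore] Relabel the limit of a `Tendsto` by an equal constant. -/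
private theorem tendsto_of_tendsto_of_eq_ef {f : ℝ → ℝ} {L c : ℝ} (h : Tendsto f atTop (𝓝 L)) (e : L = c) :
    Tendsto f atTop (𝓝 c) := e ▸ h

/-- `f_s(y) = Λ_{2s}(y)/(β(y)²)^s`. [cite: MadrasSlade1993, Section 4.2, (4.2.2) (p. 91)] -/
private theorem pwbLaw_eq_ef (y : ℝ) (s : ℕ) : pwbLaw y s = IPWB (2 * s) y / (wallRate y ^ 2) ^ s := by
  rw [pwbLaw, pow_mul]

/-- A lower bound for `Λ_{2s}(y)` is a lower bound for `f_s(y)·(β²)^s`. [cite: MadrasSlade1993, Section 4.2, (4.2.2) (p. 91)] -/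
private theorem div_le_pwbLaw_ef {s m : ℕ} (hm : m = 2 * s) {a : ℝ} (ha : a ≤ IPWB m y) : a / (wallRate y ^ 2) ^ s ≤ pwbLaw y s := by
  subst hm
  rw [pwbLaw_eq_ef]
  exact div_le_div_of_nonneg_right ha (pow_nonneg (sq_nonneg _) _)

/-- Kesten partial sums: `Σ_{s ∈ S} f_s(y) ≤ 1` for `y > μ³`. [cite: MadrasSlade1993, Section 4.2, (4.2.4) and Theorem 4.2.2 (pp. 91–92)] [cite: Kesten1963SAW, Section 4] -/
private theorem sum_pwbLaw_le_one_ef (hy : hexConnectiveConstant ^ 3 < y) (S : Finset ℕ) : ∑ s ∈ S, pwbLaw y s ≤ 1 := by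
  have hμ := hexConnectiveConstant_pos
  have hy0 : 0 ≤ y := le_of_lt (lt_of_le_of_lt (by positivity) hy)
  exact sum_le_hasSum S (fun s _ => pwbLaw_nonneg hy0 s) (hasSum_pwbLaw_of_cube_lt hy)

/-- `f₁(y) ≥ y/β²` (the atom `(0,0) → (1,0) → (2,0)`). [cite: MadrasSlade1993, Section 4.2, (4.2.2) (p. 91)] -/
private theorem div_sq_wallRate_le_pwbLaw_one_ef (hy : 0 ≤ y) : y / wallRate y ^ 2 ≤ pwbLaw y 1 := by
  obtain ⟨m, hm⟩ : ∃ m : ℕ, m = 2 * 1 := ⟨_, rfl⟩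
  have h := straightWalk_mem_pwb 1
  rw [← hm] at h
  have hmem : Zd.straightWalk 2 m ∈ ipwb m := by
    rw [mem_ipwb]
    refine ⟨h.1, by omega, fun k hk1 hk2 hr => ?_⟩
    have hk : k % 2 = 0 := hr.2.1
    omega
  have h1 : y ^ visits m (Zd.straightWalk 2 m) ≤ IPWB m y := Finset.single_le_sum (fun _ _ => pow_nonneg hy _) hmem
  rw [h.2] at h1
  have h2 := div_le_pwbLaw_ef hm h1
  rwa [pow_one, pow_one] at h2

/-! ### §1  The sixth rung of the `β²`-tower: `y⁶(1 − y/β²) − y⁴ − y³ − y² − 2y → 2` (from the exact sixth order `a₅ = 6`) -/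

/-- ★ **`y⁶ (1 − y/β(y)²) − y⁴ − y³ − y² − 2y → 2`**, i.e. `1 − y/β² = 1/y² + 1/y³ + 1/y⁴ + 2/y⁵ + 2/y⁶ + o(y⁻⁶)` — from the sixth-order limit
`y⁵(β² − y − 1/y − 1/y² − 2/y³ − 4/y⁴) → 6` («SIXTH-LOWER») by the identity `K = D₅·r − P − Q − 2A − 4A/y` (`r = y/β²`, `A = y²(1 − r)`, `Q = y³(1 − r) − y`,
`P = y⁴(1 − r) − y² − y`, `D₅ → 6`). [cite: BeatonBousquetMelouDeGierDuminilCopinGuttmann2014, Section 3.1, Proposition 5 (arXiv v5 p. 9) and p. 10] -/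
theorem tendsto_pow_six_mul_one_sub_div_sub :
    Tendsto (fun y : ℝ => y ^ 6 * (1 - y / wallRate y ^ 2) - y ^ 4 - y ^ 3 - y ^ 2 - 2 * y) atTop (𝓝 2) := by
  have hr := tendsto_div_wallRate_sq
  have hA := tendsto_sq_mul_one_sub_div_wallRate_sq
  have hQ := tendsto_cube_mul_one_sub_div_sub
  have hP := tendsto_pow_four_mul_one_sub_div_sub
  have hD := tendsto_pow_five_mul_wallRate_sq_sub
  have hu : Tendsto (fun y : ℝ => y⁻¹) atTop (𝓝 0) := tendsto_inv_atTop_zero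
  have h := ((((hD.mul hr).sub hP).sub hQ).sub (hA.const_mul 2)).sub ((hA.mul hu).const_mul 4)
  refine Tendsto.congr' ?_ (tendsto_of_tendsto_of_eq_ef h (by norm_num))
  filter_upwards [eventually_gt_atTop (0 : ℝ)] with y hy
  have hw : wallRate y ≠ 0 := (wallRate_pos y).ne'
  have hy' : y ≠ 0 := hy.ne'
  field_simp
  ring

/-! ### §2  Kesten's identity over the exhibited classes: the eighth-order partial sum is at most one -/

/-- ★★ **The eighth-order partial sum.**  For `y > μ³`, with `B = β(y)²`:
`y/B + y/B³ + y/B⁴ + 3y/B⁵ + (6y + y²)/B⁶ + (15y + 3y²)/B⁷ + (38y + 11y²)/B⁸ + (98y + 34y² + y³)/B⁹ + (99y² + 7y³)/B¹⁰ + 33y³/B¹¹ + y⁴/B¹² ≤ 1`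
— Kesten's identity `Σ_s f_s(y) = 1` restricted to `s ∈ {1, 3, …, 12}`, with `f₁ ≥ y/B`, the exact `f₃, …, f₈` and the exhibited lower bounds of «BLOCKS-EIGHT-A/B»
for `f₉, …, f₁₂`. [cite: Kesten1963SAW, Section 4] [cite: MadrasSlade1993, Section 4.2, (4.2.4) and Theorem 4.2.2 (pp. 91–92)] -/
theorem eighth_order_partial_sum_le_one (hy : hexConnectiveConstant ^ 3 < y) :
    y / wallRate y ^ 2 + y / (wallRate y ^ 2) ^ 3 + y / (wallRate y ^ 2) ^ 4 + 3 * y / (wallRate y ^ 2) ^ 5 +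
      (6 * y + y ^ 2) / (wallRate y ^ 2) ^ 6 + (15 * y + 3 * y ^ 2) / (wallRate y ^ 2) ^ 7 +
      (38 * y + 11 * y ^ 2) / (wallRate y ^ 2) ^ 8 + (98 * y + 34 * y ^ 2 + y ^ 3) / (wallRate y ^ 2) ^ 9 +
      (99 * y ^ 2 + 7 * y ^ 3) / (wallRate y ^ 2) ^ 10 + 33 * y ^ 3 / (wallRate y ^ 2) ^ 11 + y ^ 4 / (wallRate y ^ 2) ^ 12 ≤ 1 := by
  have hμ := hexConnectiveConstant_pos
  have hy0 : 0 ≤ y := le_of_lt (lt_of_le_of_lt (by positivity) hy)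
  have hS := sum_pwbLaw_le_one_ef hy {1, 3, 4, 5, 6, 7, 8, 9, 10, 11, 12}
  rw [Finset.sum_insert (by decide), Finset.sum_insert (by decide), Finset.sum_insert (by decide), Finset.sum_insert (by decide),
    Finset.sum_insert (by decide), Finset.sum_insert (by decide), Finset.sum_insert (by decide), Finset.sum_insert (by decide),
    Finset.sum_insert (by decide), Finset.sum_insert (by decide), Finset.sum_singleton] at hS
  have h1 := div_sq_wallRate_le_pwbLaw_one_ef hy0
  have h3 : pwbLaw y 3 = y / (wallRate y ^ 2) ^ 3 := by rw [pwbLaw_three, ← pow_mul]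
  have h4 : pwbLaw y 4 = y / (wallRate y ^ 2) ^ 4 := by rw [pwbLaw_four_eq, ← pow_mul]
  have h5 : pwbLaw y 5 = 3 * y / (wallRate y ^ 2) ^ 5 := by rw [pwbLaw_five_eq, ← pow_mul]
  have h6 : pwbLaw y 6 = (6 * y + y ^ 2) / (wallRate y ^ 2) ^ 6 := by rw [pwbLaw_six_eq_six, ← pow_mul]
  have h7 : pwbLaw y 7 = (15 * y + 3 * y ^ 2) / (wallRate y ^ 2) ^ 7 := by rw [pwbLaw_seven_eq_exact, ← pow_mul]
  have h8 : pwbLaw y 8 = (38 * y + 11 * y ^ 2) / (wallRate y ^ 2) ^ 8 := by rw [pwbLaw_eight_eq_exact, ← pow_mul]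
  have h9 := div_le_pwbLaw_ef (s := 9) (m := 18) (by norm_num) (ninetyEight_mul_add_le_IPWB_eighteen rfl hy0)
  have h10 := div_le_pwbLaw_ef (s := 10) (m := 20) (by norm_num) (ninetyNine_sq_add_seven_cube_le_IPWB_twenty rfl hy0)
  have h11 := div_le_pwbLaw_ef (s := 11) (m := 22) (by norm_num) (thirtyThree_cube_le_IPWB_twentytwo rfl hy0)
  have h12 := div_le_pwbLaw_ef (s := 12) (m := 24) (by norm_num) (pow_four_le_IPWB_twentyfour rfl hy0)
  linarith

/-! ### §3  The closed-form eighth-order lower bound -/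

/-- ★★ **THE EIGHTH-ORDER LOWER BOUND IN CLOSED FORM.**  For `y > μ³`, with `r = y/β(y)²`:
`y⁶(r² − 1) + y⁵(r³ − 1) + y⁴(3r⁴ + r⁵ − 2) + y³(6r⁵ + 3r⁶ − 4) + y²(15r⁶ + 11r⁷ + r⁸ − 6) + y(38r⁷ + 34r⁸ + 7r⁹ − 12) + (98r⁸ + 99r⁹ + 33r¹⁰ + r¹¹)`
`≤ y⁷ (β(y)² − y − 1/y − 1/y² − 2/y³ − 4/y⁴ − 6/y⁵ − 12/y⁶)`.
(The difference of the two sides is `y⁷ β² · (1 − partial sum) ≥ 0`.)  The left side tends to `18` (§4).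
[cite: Kesten1963SAW, Section 4] [cite: MadrasSlade1993, Section 4.2, (4.2.4) (p. 91)] [cite: BeatonBousquetMelouDeGierDuminilCopinGuttmann2014, Section 3.1, Proposition 5 (arXiv v5 p. 9)] -/
theorem eighth_order_lower (hy : hexConnectiveConstant ^ 3 < y) :
    y ^ 6 * ((y / wallRate y ^ 2) ^ 2 - 1) + y ^ 5 * ((y / wallRate y ^ 2) ^ 3 - 1) +
        y ^ 4 * (3 * (y / wallRate y ^ 2) ^ 4 + (y / wallRate y ^ 2) ^ 5 - 2) +
        y ^ 3 * (6 * (y / wallRate y ^ 2) ^ 5 + 3 * (y / wallRate y ^ 2) ^ 6 - 4) +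
        y ^ 2 * (15 * (y / wallRate y ^ 2) ^ 6 + 11 * (y / wallRate y ^ 2) ^ 7 + (y / wallRate y ^ 2) ^ 8 - 6) +
        y * (38 * (y / wallRate y ^ 2) ^ 7 + 34 * (y / wallRate y ^ 2) ^ 8 + 7 * (y / wallRate y ^ 2) ^ 9 - 12) +
        (98 * (y / wallRate y ^ 2) ^ 8 + 99 * (y / wallRate y ^ 2) ^ 9 + 33 * (y / wallRate y ^ 2) ^ 10 + (y / wallRate y ^ 2) ^ 11) ≤
      y ^ 7 * (wallRate y ^ 2 - y - 1 / y - 1 / y ^ 2 - 2 / y ^ 3 - 4 / y ^ 4 - 6 / y ^ 5 - 12 / y ^ 6) := by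
  have hμ := hexConnectiveConstant_pos
  have hy0 : 0 < y := lt_of_le_of_lt (by positivity) hy
  have hB : 0 < wallRate y ^ 2 := pow_pos (wallRate_pos y) 2
  have hK := eighth_order_partial_sum_le_one hy
  set B := wallRate y ^ 2 with hBdef
  set K := y / B + y / B ^ 3 + y / B ^ 4 + 3 * y / B ^ 5 + (6 * y + y ^ 2) / B ^ 6 + (15 * y + 3 * y ^ 2) / B ^ 7 +
    (38 * y + 11 * y ^ 2) / B ^ 8 + (98 * y + 34 * y ^ 2 + y ^ 3) / B ^ 9 + (99 * y ^ 2 + 7 * y ^ 3) / B ^ 10 + 33 * y ^ 3 / B ^ 11 +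
    y ^ 4 / B ^ 12 with hKdef
  have key : y ^ 7 * (B - y - 1 / y - 1 / y ^ 2 - 2 / y ^ 3 - 4 / y ^ 4 - 6 / y ^ 5 - 12 / y ^ 6) -
      (y ^ 6 * ((y / B) ^ 2 - 1) + y ^ 5 * ((y / B) ^ 3 - 1) + y ^ 4 * (3 * (y / B) ^ 4 + (y / B) ^ 5 - 2) +
        y ^ 3 * (6 * (y / B) ^ 5 + 3 * (y / B) ^ 6 - 4) + y ^ 2 * (15 * (y / B) ^ 6 + 11 * (y / B) ^ 7 + (y / B) ^ 8 - 6) +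
        y * (38 * (y / B) ^ 7 + 34 * (y / B) ^ 8 + 7 * (y / B) ^ 9 - 12) +
        (98 * (y / B) ^ 8 + 99 * (y / B) ^ 9 + 33 * (y / B) ^ 10 + (y / B) ^ 11)) =
      y ^ 7 * B * (1 - K) := by
    rw [hKdef]
    field_simp
    ring
  have hpos : 0 ≤ y ^ 7 * B * (1 - K) := mul_nonneg (mul_nonneg (pow_nonneg hy0.le 7) hB.le) (sub_nonneg.2 hK)
  linarith

/-! ### §4  The limit of the comparison function and the floor -/

/-- ★★ The lower comparison function tends to eighteen: with `r = y/β(y)²`,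
`y⁶(r² − 1) + y⁵(r³ − 1) + y⁴(3r⁴ + r⁵ − 2) + y³(6r⁵ + 3r⁶ − 4) + y²(15r⁶ + 11r⁷ + r⁸ − 6) + y(38r⁷ + 34r⁸ + 7r⁹ − 12) + (98r⁸ + 99r⁹ + 33r¹⁰ + r¹¹) → 18`
— an exact polynomial identity in the tower `A, Q, P, H, K` and `u = 1/y` (orders one to six EXACT), `Φ(1, 1, 1, 2, 2, 0) = 18 = 231 − 213`.
[cite: BeatonBousquetMelouDeGierDuminilCopinGuttmann2014, Section 3.1, Proposition 5 (arXiv v5 p. 9)] [cite: MadrasSlade1993, Section 4.2, (4.2.4) (p. 91)] -/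
theorem tendsto_eighth_order_lower :
    Tendsto (fun y : ℝ => y ^ 6 * ((y / wallRate y ^ 2) ^ 2 - 1) + y ^ 5 * ((y / wallRate y ^ 2) ^ 3 - 1) +
        y ^ 4 * (3 * (y / wallRate y ^ 2) ^ 4 + (y / wallRate y ^ 2) ^ 5 - 2) +
        y ^ 3 * (6 * (y / wallRate y ^ 2) ^ 5 + 3 * (y / wallRate y ^ 2) ^ 6 - 4) +
        y ^ 2 * (15 * (y / wallRate y ^ 2) ^ 6 + 11 * (y / wallRate y ^ 2) ^ 7 + (y / wallRate y ^ 2) ^ 8 - 6) +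
        y * (38 * (y / wallRate y ^ 2) ^ 7 + 34 * (y / wallRate y ^ 2) ^ 8 + 7 * (y / wallRate y ^ 2) ^ 9 - 12) +
        (98 * (y / wallRate y ^ 2) ^ 8 + 99 * (y / wallRate y ^ 2) ^ 9 + 33 * (y / wallRate y ^ 2) ^ 10 + (y / wallRate y ^ 2) ^ 11))
      atTop (𝓝 18) := by
  have hA := tendsto_sq_mul_one_sub_div_wallRate_sq
  have hQ := tendsto_cube_mul_one_sub_div_sub
  have hP := tendsto_pow_four_mul_one_sub_div_sub
  have hH := tendsto_pow_five_mul_one_sub_div_sub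
  have hK := tendsto_pow_six_mul_one_sub_div_sub
  have hu : Tendsto (fun y : ℝ => y⁻¹) atTop (𝓝 0) := tendsto_inv_atTop_zero
  have h := ((((((((((((((((((((((((((((((((((((((((((((((hA.pow 2).const_mul (28 : ℝ)).add
      ((hA.mul hQ).const_mul (3 : ℝ))).add
      (hA.const_mul ((-175) : ℝ))).add
      (hQ.pow 2)).add
      (hQ.const_mul ((-45) : ℝ))).add
      (hP.const_mul ((-15) : ℝ))).add
      (hH.const_mul ((-3) : ℝ))).add
      (hK.const_mul ((-2) : ℝ))).add
      (tendsto_const_nhds (x := (231 : ℝ)))).add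
      (((hA.pow 3).mul hu).const_mul ((-1) : ℝ))).add
      (((hA.pow 2).mul hu).const_mul (105 : ℝ))).add
      ((hA.mul hu).const_mul ((-601) : ℝ))).add
      (((hA.pow 3).mul (hu.pow 2)).const_mul ((-22) : ℝ))).add
      (((hA.pow 2).mul (hu.pow 2)).const_mul (484 : ℝ))).add
      ((hA.mul (hu.pow 2)).const_mul ((-2016) : ℝ))).add
      (((hA.pow 3).mul (hu.pow 3)).const_mul ((-120) : ℝ))).add
      (((hA.pow 2).mul (hu.pow 3)).const_mul (2002 : ℝ))).add
      (((hA.pow 4).mul (hu.pow 4)).const_mul (8 : ℝ))).add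
      (((hA.pow 3).mul (hu.pow 4)).const_mul ((-741) : ℝ))).add
      (((hA.pow 2).mul (hu.pow 4)).const_mul (7848 : ℝ))).add
      (((hA.pow 4).mul (hu.pow 5)).const_mul (75 : ℝ))).add
      (((hA.pow 3).mul (hu.pow 5)).const_mul ((-3822) : ℝ))).add
      (((hA.pow 5).mul (hu.pow 6)).const_mul ((-1) : ℝ))).add
      (((hA.pow 4).mul (hu.pow 6)).const_mul (680 : ℝ))).add
      (((hA.pow 3).mul (hu.pow 6)).const_mul ((-17929) : ℝ))).add
      (((hA.pow 5).mul (hu.pow 7)).const_mul ((-24) : ℝ))).add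
      (((hA.pow 4).mul (hu.pow 7)).const_mul (4592 : ℝ))).add
      (((hA.pow 5).mul (hu.pow 8)).const_mul ((-377) : ℝ))).add
      (((hA.pow 4).mul (hu.pow 8)).const_mul (26594 : ℝ))).add
      (((hA.pow 6).mul (hu.pow 9)).const_mul (3 : ℝ))).add
      (((hA.pow 5).mul (hu.pow 9)).const_mul ((-3584) : ℝ))).add
      (((hA.pow 6).mul (hu.pow 10)).const_mul (120 : ℝ))).add
      (((hA.pow 5).mul (hu.pow 10)).const_mul ((-26740) : ℝ))).add
      (((hA.pow 6).mul (hu.pow 11)).const_mul (1806 : ℝ))).add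
      (((hA.pow 7).mul (hu.pow 12)).const_mul ((-19) : ℝ))).add
      (((hA.pow 6).mul (hu.pow 12)).const_mul (18452 : ℝ))).add
      (((hA.pow 7).mul (hu.pow 13)).const_mul ((-562) : ℝ))).add
      ((hA.pow 8).mul (hu.pow 14))).add
      (((hA.pow 7).mul (hu.pow 14)).const_mul ((-8638) : ℝ))).add
      (((hA.pow 8).mul (hu.pow 15)).const_mul (97 : ℝ))).add
      (((hA.pow 8).mul (hu.pow 16)).const_mul (2639 : ℝ))).add
      (((hA.pow 9).mul (hu.pow 17)).const_mul ((-7) : ℝ))).add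
      (((hA.pow 9).mul (hu.pow 18)).const_mul ((-484) : ℝ))).add
      (((hA.pow 10).mul (hu.pow 20)).const_mul (44 : ℝ))).add
      (((hA.pow 11).mul (hu.pow 22)).const_mul ((-1) : ℝ)))
  refine Tendsto.congr' ?_ (tendsto_of_tendsto_of_eq_ef h (by norm_num))
  filter_upwards [eventually_gt_atTop (0 : ℝ)] with y hy
  have hw : wallRate y ≠ 0 := (wallRate_pos y).ne'
  have hy' : y ≠ 0 := hy.ne'
  field_simp
  ring

/-- ★★ **THE EIGHTH-ORDER FLOOR:** for every `ε > 0`, eventually `18 − ε ≤ y⁷ (β(y)² − y − 1/y − 1/y² − 2/y³ − 4/y⁴ − 6/y⁵ − 12/y⁶)`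
(`liminf ≥ 18`; `18 = N₉,₁ + N₁₀,₂ + N₁₁,₃ + N₁₂,₄ − 213 = 98 + 99 + 33 + 1 − 213` in the census bookkeeping).
[cite: BeatonBousquetMelouDeGierDuminilCopinGuttmann2014, Section 3.1, Proposition 5 (arXiv v5 p. 9); p. 10 (first-order remark)] [cite: Kesten1963SAW, Section 4] [cite: MadrasSlade1993, Section 4.2, Theorem 4.2.2 (pp. 91–92)] -/
theorem eventually_eighteen_sub_le_pow_seven_mul_wallRate_sq_sub {ε : ℝ} (hε : 0 < ε) :
    ∀ᶠ y : ℝ in atTop, 18 - ε ≤ y ^ 7 * (wallRate y ^ 2 - y - 1 / y - 1 / y ^ 2 - 2 / y ^ 3 - 4 / y ^ 4 - 6 / y ^ 5 - 12 / y ^ 6) := by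
  have hlo := tendsto_eighth_order_lower.eventually (eventually_gt_nhds (show (18 : ℝ) - ε < 18 by linarith))
  filter_upwards [hlo, eventually_gt_atTop (hexConnectiveConstant ^ 3)] with y h1 hy
  exact h1.le.trans (eighth_order_lower hy)

/-- ★★ The floor as an inequality for `β²`: for every `ε > 0`, eventually
`y + 1/y + 1/y² + 2/y³ + 4/y⁴ + 6/y⁵ + 12/y⁶ + (18 − ε)/y⁷ ≤ β(y)²`. [cite: BeatonBousquetMelouDeGierDuminilCopinGuttmann2014, Section 3.1, Proposition 5 (arXiv v5 p. 9)] -/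
theorem eventually_eighth_order_floor {ε : ℝ} (hε : 0 < ε) :
    ∀ᶠ y : ℝ in atTop, y + 1 / y + 1 / y ^ 2 + 2 / y ^ 3 + 4 / y ^ 4 + 6 / y ^ 5 + 12 / y ^ 6 + (18 - ε) / y ^ 7 ≤ wallRate y ^ 2 := by
  filter_upwards [eventually_eighteen_sub_le_pow_seven_mul_wallRate_sq_sub hε, eventually_gt_atTop (0 : ℝ)] with y h1 hy
  have hy7 : 0 < y ^ 7 := pow_pos hy 7
  have e2 : wallRate y ^ 2 = (y + 1 / y + 1 / y ^ 2 + 2 / y ^ 3 + 4 / y ^ 4 + 6 / y ^ 5 + 12 / y ^ 6) +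
      (y ^ 7 * (wallRate y ^ 2 - y - 1 / y - 1 / y ^ 2 - 2 / y ^ 3 - 4 / y ^ 4 - 6 / y ^ 5 - 12 / y ^ 6)) / y ^ 7 := by
    field_simp
    ring
  have e : y + 1 / y + 1 / y ^ 2 + 2 / y ^ 3 + 4 / y ^ 4 + 6 / y ^ 5 + 12 / y ^ 6 + (18 - ε) / y ^ 7 =
      (y + 1 / y + 1 / y ^ 2 + 2 / y ^ 3 + 4 / y ^ 4 + 6 / y ^ 5 + 12 / y ^ 6) + (18 - ε) / y ^ 7 := by ring
  rw [e, e2]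
  gcongr

/-- ★ Consequently, IF the eighth-order limit exists, it is at least eighteen. [cite: MadrasSlade1993, Section 4.2, Theorem 4.2.2 (pp. 91–92)] -/
theorem eighteen_le_of_tendsto_pow_seven_mul_wallRate_sq_sub {L : ℝ}
    (h : Tendsto (fun y : ℝ => y ^ 7 * (wallRate y ^ 2 - y - 1 / y - 1 / y ^ 2 - 2 / y ^ 3 - 4 / y ^ 4 - 6 / y ^ 5 - 12 / y ^ 6)) atTop (𝓝 L)) :
    18 ≤ L := by
  refine le_of_tendsto_of_tendsto tendsto_eighth_order_lower h ?_
  filter_upwards [eventually_gt_atTop (hexConnectiveConstant ^ 3)] with y hy using eighth_order_lower hy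

end Literature.Probability.RandomPlanarGeometry.SAW.HexBW.Wall
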